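import Summits.SmoothPoincare4.SmoothPoincare4.Theorems.ConvexBisectionAcyclicBisectionExistsDualHandlePush
import HarnessLib

/-!
# Dual handles, XII: the model push `sh` of `X₁` — image of the handle part and the new seam
(brick (PUSH-d) of the sub-goal T3b step (ii) "push the prefix sub-handlebody `X₁` off the cocore
neighbourhood `N` of the suffix handles" of stub `stub_steinRealisation` (NF6), line
`modp-braid-orbits` r11, crux `ConvexBisection.AcyclicBisectionExists`, item
stmt-SmoothPoincare4-10508; wave 3, lead c5, worker Z3)

Sequel of `…DualHandlePush.lean` (`sh = modelPush κ δ`, a torus-equivariant diffeomorphism of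
`{x_λ ≠ 0}` onto `pushInvDom κ δ`, acting on `(P, Q) = (‖x_λ‖², ‖x_μ‖²)` by
`(P, Q) ↦ (pushP κ P (g(P)Q/δ), g(P) Q)`).  Here: **what `sh` does to the handle part
`{x_λ ≠ 0, ‖x‖ ≤ 1}` (= `X₁ ∖ γ` in the handle chart)**:

* `image_modelPush_ball` — `sh '' {x_λ ≠ 0, ‖x‖ ≤ 1} = pushTarget κ δ`, the set
  `{‖x‖ ≤ 1, Q ≤ ϱ(P), (δ/4 ≤ Q ∨ pFun κ (Q/δ) ≤ P), (x_μ = 0 → pFun κ 0 < P)}`; in terms of the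
  model function `H` of the cocore neighbourhood `N` (worker Z2) this is `{‖x‖ ≤ 1, 0 ≤ H} ∖ C`
  (`…DualHandlePushRegion.lean`): the handle minus the part `{H < 0}` of
  `N = {Q ≤ δ/2, P ≤ pFun κ (Q/δ)} ∪ {δ/4 ≤ Q, P ≤ 3κ²/4, ϱ(P) ≤ Q}` (the new boundary `{H = 0}` IS
  attained), minus the circle `C = {x_μ = 0, P = pFun κ 0 = κ²/8}` — the image of the attaching
  circle `γ` itself under the globalised push (`γ` is not in the chart: Kosinski's inversion blows it
  up into the cocore disc `{P = 0}`, which `sh` blows down onto `C`);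
* `modelPush_seam` — the seam `{‖x‖ = 1, 0 < P < 3κ²/4}` goes ONTO the new boundary `∂N`:
  the ridge `Q = ϱ(P)` above `Q = δ/4` and the swap-slab boundary `P = pFun κ (Q/δ)` below;
* `helper_pushModel` (registered) — the whole route-A package of the brief in tree vocabulary.

Everything here is proved; no named facts.

## References
* J. Milnor, *Lectures on the h-cobordism theorem* (1965), §3 (dual handles). [MilnorHCobordism1965]
* A. A. Kosinski, *Differential Manifolds* (1993), VI §6. [Kosinski1993]
-/

noncomputable section

-- the prescribed namespace `Summit.<P>.<Sub>.…` duplicates `SmoothPoincare4` (P = Sub)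
set_option linter.dupNamespace false

open scoped Manifold ContDiff Topology

namespace Summit.SmoothPoincare4.SmoothPoincare4.Theorems.AcyclicBisectionExists.ModpBraidOrbits

open Set Function Metric
open Literature.Topology.FourManifolds Literature.Topology.FourManifolds.HandleAttachingMap

namespace PushModel

section Image

variable {κ δ : ℝ}

/-- `pFun κ 0 = κ²/8` (the level of the circle `C = sh(γ)`). [folklore] -/
theorem pFun_zero (κ : ℝ) : pFun κ 0 = κ ^ 2 / 8 := by
  have : coreCut 0 = 0 := Real.smoothTransition.zero_of_nonpos (by norm_num)
  rw [pFun, this]; ring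

/-- **The image of the handle part**: `{‖x‖ ≤ 1, Q ≤ ϱ(P), (δ/4 ≤ Q ∨ pFun κ (Q/δ) ≤ P),
(x_μ = 0 → pFun κ 0 < P)}` (= `{‖x‖ ≤ 1, 0 ≤ H} ∖ C`, `…DualHandlePushRegion.lean`). [folklore] -/
def pushTarget (κ δ : ℝ) : Set (EuclideanSpace ℝ (Fin 4)) :=
  {x | ‖x‖ ≤ 1 ∧ muN x ≤ ridge κ δ (sOf x) ∧ (δ / 4 ≤ muN x ∨ pFun κ (muN x / δ) ≤ sOf x) ∧
    (muPart x = 0 → pFun κ 0 < sOf x)}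

/-- `‖x‖ ≤ 1 ↔ P + Q ≤ 1`. [folklore] -/
theorem norm_le_one_iff (x : EuclideanSpace ℝ (Fin 4)) : ‖x‖ ≤ 1 ↔ sOf x + muN x ≤ 1 := by
  rw [sOf, muN, ← norm_sq_eq_lamPart_muPart]
  constructor
  · intro h; nlinarith [norm_nonneg x]
  · intro h; nlinarith [norm_nonneg x]

/-- `x_μ = 0 ↔ Q = 0`. [folklore] -/
theorem muPart_eq_zero_iff (x : EuclideanSpace ℝ (Fin 4)) : muPart x = 0 ↔ muN x = 0 := by
  rw [muN, sq_eq_zero_iff, norm_eq_zero]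

/-- `g(P) Q ≤ ϱ(P)` on the handle (`Q ≤ 1 - P`). [folklore] -/
theorem mul_muN_le_ridge (hκ : 0 < κ) (hκ2 : κ ≤ 1 / 2) (hδ : 0 < δ) {x : EuclideanSpace ℝ (Fin 4)}
    (hP : 0 < sOf x) (h1 : sOf x + muN x ≤ 1) : muScaleSq κ δ (sOf x) * muN x ≤ ridge κ δ (sOf x) := by
  have hg := muScaleSq_pos hκ hκ2 hδ hP
  rcases lt_or_ge (sOf x) 1 with h | h
  · rw [← one_sub_mul_muScaleSq hκ h, mul_comm (1 - sOf x)]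
    exact mul_le_mul_of_nonneg_left (by linarith) hg.le
  · have hQ : muN x = 0 := le_antisymm (by linarith) (sq_nonneg _)
    have hκsq : κ ^ 2 ≤ 1 / 4 := by nlinarith
    rw [hQ, mul_zero, ridge_of_ge hκ (by linarith)]
    linarith

/-- **`sh` maps the handle part into `pushTarget`.** [folklore] -/
theorem modelPush_mem_pushTarget (hκ : 0 < κ) (hκ2 : κ ≤ 1 / 2) (hδ : 0 < δ) (hδ2 : δ ≤ 1 / 2)
    {x : EuclideanSpace ℝ (Fin 4)} (hx : lamPart x ≠ 0) (h1 : ‖x‖ ≤ 1) : modelPush κ δ x ∈ pushTarget κ δ := by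
  have hP := sOf_pos_iff.2 hx
  rw [norm_le_one_iff] at h1
  set P := sOf x with hPd
  set g := muScaleSq κ δ P with hgd
  have hg : 0 < g := muScaleSq_pos hκ hκ2 hδ hP
  set q := g * muN x / δ with hqd
  have hQ₁ : g * muN x = δ * q := by rw [hqd]; field_simp
  have hq0 : 0 ≤ q := by rw [hqd]; exact div_nonneg (mul_nonneg hg.le (sq_nonneg _)) hδ.le
  have hsP : sOf (modelPush κ δ x) = pushP κ P q := sOf_modelPush hκ hx
  have hsQ : muN (modelPush κ δ x) = g * muN x := muN_modelPush hκ hκ2 hδ hx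
  have hridge : g * muN x ≤ ridge κ δ P := mul_muN_le_ridge hκ hκ2 hδ hP h1
  have hκsq : κ ^ 2 ≤ 1 / 4 := by nlinarith
  have hmono := (pushP_strictMono hκ q).monotone
  refine ⟨?_, ?_, ?_, ?_⟩
  · -- `‖sh x‖ ≤ 1`
    rw [norm_le_one_iff, hsP, hsQ]
    rcases lt_or_ge P (κ ^ 2 / 2) with h | h
    · have := (pushP_mem hκ h (q := q)).2
      rw [ridge_of_le hκ h.le] at hridge
      have : δ * P / κ ^ 2 ≤ δ / 2 := by rw [div_le_iff₀ (by positivity)]; nlinarith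
      linarith
    · rw [pushP_of_ge q h]; linarith [ridge_le hκ hκ2 hδ hδ2 P]
  · -- `Q' ≤ ϱ(P')`
    rw [hsP, hsQ]
    rcases lt_or_ge P (κ ^ 2 / 2) with h | h
    · have hm := pushP_mem hκ h (q := q)
      rw [ridge_of_le hκ hm.2.le]
      rw [ridge_of_le hκ h.le] at hridge
      have : δ * P / κ ^ 2 ≤ δ * pushP κ P q / κ ^ 2 := by gcongr; exact hm.1
      linarith
    · rwa [pushP_of_ge q h]
  · -- `δ/4 ≤ Q'` or `pFun κ (Q'/δ) ≤ P'`
    rw [hsP, hsQ, hQ₁, mul_div_cancel_left₀ _ hδ.ne']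
    by_cases hq : 1 / 4 ≤ q
    · left; nlinarith
    · right
      have hq' : q < 1 / 4 := not_le.1 hq
      rcases lt_or_ge P (κ ^ 2 / 2) with h | h
      · have hle : κ ^ 2 * q ≤ P := by
          rw [ridge_of_le hκ h.le, hQ₁] at hridge
          rw [le_div_iff₀ (by positivity)] at hridge
          nlinarith
        have := hmono hle
        simp only at this
        rwa [pushP_base hκ q] at this
      · rw [pushP_of_ge q h]; linarith [pFun_lt_half hκ (show q < 1 / 2 by linarith)]
  · -- off `x_μ = 0`: `pFun κ 0 < P'`
    intro h0
    rw [muPart_eq_zero_iff, hsQ, mul_eq_zero] at h0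
    have hQ0 : muN x = 0 := h0.resolve_left hg.ne'
    have hq00 : q = 0 := by rw [hqd, hQ0, mul_zero, zero_div]
    rw [hsP, hq00]
    rcases lt_or_ge P (κ ^ 2 / 2) with h | h
    · have := pushP_strictMono hκ 0 hP
      have hb := pushP_base hκ 0
      rw [mul_zero] at hb
      simp only at this
      rwa [hb] at this
    · rw [pushP_of_ge 0 h, pFun_zero]; linarith

/-- Points of `pushTarget` have `P > 0`. [folklore] -/
theorem sOf_pos_of_mem_pushTarget (hκ : 0 < κ) {x : EuclideanSpace ℝ (Fin 4)} (hx : x ∈ pushTarget κ δ) :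
    0 < sOf x := by
  obtain ⟨-, h2, -, h4⟩ := hx
  by_contra h
  have h0 : sOf x = 0 := le_antisymm (not_lt.1 h) (sq_nonneg _)
  have hr : ridge κ δ (sOf x) = 0 := by rw [h0, ridge_of_le hκ (by positivity)]; ring
  have hQ : muN x = 0 := le_antisymm (by rw [← hr]; exact h2) (sq_nonneg _)
  have := h4 ((muPart_eq_zero_iff x).2 hQ)
  rw [h0, pFun_zero] at this
  nlinarith [sq_nonneg κ]

/-- **`pushTarget ⊆ pushInvDom`** (the target of the handle part lies in the diffeomorphism range).
[folklore] -/
theorem mem_pushInvDom_of_mem_pushTarget (hκ : 0 < κ) (hδ : 0 < δ) {x : EuclideanSpace ℝ (Fin 4)}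
    (hx : x ∈ pushTarget κ δ) : x ∈ pushInvDom κ δ := by
  have hP := sOf_pos_of_mem_pushTarget hκ hx
  obtain ⟨-, -, h3, h4⟩ := hx
  rw [pushInvDom, mem_setOf_eq]
  rcases lt_or_ge (sOf x) (κ ^ 2 / 2) with h | h
  · apply mem_pullDom_of_exp_lt h
    set q := muN x / δ with hqd
    have hq0 : 0 ≤ q := div_nonneg (sq_nonneg _) hδ.le
    show Real.exp (2 / κ ^ 2) + pushShift κ q < Real.exp (1 / (κ ^ 2 / 2 - sOf x))
    have h2κ : 2 / κ ^ 2 = 1 / (κ ^ 2 / 2) := by field_simp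
    rcases lt_or_ge q (1 / 4) with hq | hq
    · have hQlt : muN x < δ / 4 := by
        have hq' := hq
        rw [hqd, div_lt_iff₀ hδ] at hq'
        linarith
      have hpf : pFun κ q ≤ sOf x := h3.resolve_left (not_le.2 hQlt)
      have hbase : Real.exp (2 / κ ^ 2) ≤ Real.exp (1 / (κ ^ 2 / 2 - κ ^ 2 * q)) := by
        rw [Real.exp_le_exp, h2κ]
        exact one_div_le_one_div_of_le (by nlinarith [pow_pos hκ 2]) (by nlinarith [pow_pos hκ 2])
      have htop : Real.exp (1 / (κ ^ 2 / 2 - pFun κ q)) ≤ Real.exp (1 / (κ ^ 2 / 2 - sOf x)) :=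
        Real.exp_le_exp.2 (one_div_le_one_div_of_le (by linarith) (by linarith))
      rw [pushShift_of_lt hq]
      rcases eq_or_lt_of_le hq0 with hq00 | hqpos
      · -- `q = 0`: strictness from `pFun κ 0 < P`
        have hQ0 : muN x = 0 := by
          have h0 : muN x / δ = 0 := by rw [← hqd, ← hq00]
          rcases div_eq_zero_iff.1 h0 with h0' | h0'
          · exact h0'
          · exact absurd h0' hδ.ne'
        have hlt : pFun κ q < sOf x := by rw [← hq00]; exact h4 ((muPart_eq_zero_iff x).2 hQ0)
        have htop' : Real.exp (1 / (κ ^ 2 / 2 - pFun κ q)) < Real.exp (1 / (κ ^ 2 / 2 - sOf x)) :=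
          Real.exp_lt_exp.2 (one_div_lt_one_div_of_lt (by linarith) (by linarith))
        linarith
      · -- `q > 0`: strictness from the base inequality
        have hbase' : Real.exp (2 / κ ^ 2) < Real.exp (1 / (κ ^ 2 / 2 - κ ^ 2 * q)) := by
          rw [Real.exp_lt_exp, h2κ]
          exact one_div_lt_one_div_of_lt (by nlinarith [pow_pos hκ 2]) (by nlinarith [pow_pos hκ 2])
        linarith
    · rw [pushShift_of_ge hq, add_zero, Real.exp_lt_exp, h2κ]
      exact one_div_lt_one_div_of_lt (by linarith) (by linarith)
  · exact mem_pullDom_of_ge h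

/-- **`sh⁻¹` maps `pushTarget` into the handle.** [folklore] -/
theorem norm_modelPushInv_le_one (hκ : 0 < κ) (hκ2 : κ ≤ 1 / 2) (hδ : 0 < δ) {x : EuclideanSpace ℝ (Fin 4)}
    (hx : x ∈ pushTarget κ δ) : ‖modelPushInv κ δ x‖ ≤ 1 := by
  have hV := mem_pushInvDom_of_mem_pushTarget hκ hδ hx
  have hP := sOf_pos_of_mem_pushTarget hκ hx
  obtain ⟨h1, h2, h3, -⟩ := hx
  rw [norm_le_one_iff] at h1 ⊢
  rw [sOf_modelPushInv hκ hV, muN_modelPushInv hκ hκ2 hδ hV]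
  set q := muN x / δ with hqd
  have hQ : muN x = δ * q := by rw [hqd]; field_simp
  set P₀ := pullP κ (sOf x) q with hP₀d
  have hP₀ : 0 < P₀ := pullLevel_pos hκ hV
  have hg := muScaleSq_pos hκ hκ2 hδ hP₀
  have hpush : pushP κ P₀ q = sOf x := pushP_pullLevel hκ hV
  have hκsq : κ ^ 2 ≤ 1 / 4 := by nlinarith
  -- it suffices: `Q ≤ (1 - P₀) g(P₀)`
  suffices key : muN x ≤ (1 - P₀) * muScaleSq κ δ P₀ by
    have : (muScaleSq κ δ P₀)⁻¹ * muN x ≤ 1 - P₀ := by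
      rw [inv_mul_le_iff₀ hg]; linarith
    linarith
  rcases lt_or_ge (sOf x) (κ ^ 2 / 2) with h | h
  · have hP₀le : P₀ ≤ sOf x := by rw [← hpush]; exact le_pushP hκ _ _
    have hP₀1 : P₀ < 1 := by linarith
    rw [one_sub_mul_muScaleSq hκ hP₀1, ridge_of_le hκ (by linarith)]
    -- need `κ² q ≤ P₀`
    have hle : κ ^ 2 * q ≤ P₀ := by
      rcases lt_or_ge q (1 / 4) with hq | hq
      · have hpf : pFun κ q ≤ sOf x := h3.resolve_left (by rw [not_le, hQ]; nlinarith)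
        rw [← pushP_base hκ q, ← hpush] at hpf
        exact (pushP_strictMono hκ q).le_iff_le.1 hpf
      · have h0 : P₀ = sOf x := by rw [← pushP_of_shift_zero P₀ (pushShift_of_ge hq), hpush]
        rw [h0]
        rw [ridge_of_le hκ h.le, hQ, le_div_iff₀ (by positivity)] at h2
        nlinarith
    rw [hQ, le_div_iff₀ (by positivity)]
    nlinarith
  · have h0 : P₀ = sOf x := by rw [hP₀d, pullP_of_ge q h]
    rw [h0]
    rcases lt_or_ge (sOf x) (3 * κ ^ 2 / 4) with h' | h'
    · rwa [one_sub_mul_muScaleSq hκ (by linarith)]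
    · rw [muScaleSq_of_ge hκ h', mul_one]; linarith

/-- **THE IMAGE OF THE HANDLE PART**: `sh '' {x_λ ≠ 0, ‖x‖ ≤ 1} = pushTarget κ δ`. [folklore] -/
theorem image_modelPush_ball (hκ : 0 < κ) (hκ2 : κ ≤ 1 / 2) (hδ : 0 < δ) (hδ2 : δ ≤ 1 / 2) :
    modelPush κ δ '' {x | lamPart x ≠ 0 ∧ ‖x‖ ≤ 1} = pushTarget κ δ := by
  refine Subset.antisymm ?_ fun x hx => ?_
  · rintro _ ⟨x, ⟨hx, h1⟩, rfl⟩
    exact modelPush_mem_pushTarget hκ hκ2 hδ hδ2 hx h1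
  · have hV := mem_pushInvDom_of_mem_pushTarget hκ hδ hx
    exact ⟨modelPushInv κ δ x, ⟨mapsTo_modelPushInv hκ hV, norm_modelPushInv_le_one hκ hκ2 hδ hx⟩,
      modelPush_modelPushInv hκ hκ2 hδ hV⟩

/-- **THE NEW SEAM**: a seam point `‖x‖ = 1` with `0 < P < 3κ²/4` goes to the relative boundary of
the cocore neighbourhood — onto the ridge `Q = ϱ(P)` (part `Q ≥ δ/4`) or onto the swap-slab
boundary `P = pFun κ (Q/δ)` (part `Q < δ/4`). [folklore] -/
theorem modelPush_seam (hκ : 0 < κ) (hκ2 : κ ≤ 1 / 2) (hδ : 0 < δ) (hδ2 : δ ≤ 1 / 2)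
    {x : EuclideanSpace ℝ (Fin 4)} (hx : lamPart x ≠ 0) (h1 : ‖x‖ = 1) (h2 : sOf x < 3 * κ ^ 2 / 4) :
    (δ / 4 ≤ muN (modelPush κ δ x) ∧ muN (modelPush κ δ x) = ridge κ δ (sOf (modelPush κ δ x))) ∨
    (muN (modelPush κ δ x) < δ / 4 ∧ sOf (modelPush κ δ x) = pFun κ (muN (modelPush κ δ x) / δ)) := by
  have hP := sOf_pos_iff.2 hx
  have hκsq : κ ^ 2 ≤ 1 / 4 := by nlinarith
  have hPQ : sOf x + muN x = 1 := by rw [sOf, muN, ← norm_sq_eq_lamPart_muPart, h1, one_pow]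
  have hP1 : sOf x < 1 := by linarith
  set P := sOf x with hPd
  set g := muScaleSq κ δ P with hgd
  have hQ₁ : g * muN x = ridge κ δ P := by
    rw [show muN x = 1 - P by linarith, mul_comm]; exact one_sub_mul_muScaleSq hκ hP1
  set q := g * muN x / δ with hqd
  have hQq : ridge κ δ P = δ * q := by rw [hqd, hQ₁]; field_simp
  rw [sOf_modelPush hκ hx, muN_modelPush hκ hκ2 hδ hx, ← hPd, ← hgd, ← hqd, hQ₁]
  by_cases hq : 1 / 4 ≤ q
  · left
    rw [pushP_of_shift_zero P (pushShift_of_ge hq)]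
    exact ⟨by rw [hQq]; nlinarith, rfl⟩
  · right
    have hq' : q < 1 / 4 := not_le.1 hq
    have hPlt : P < κ ^ 2 / 2 := by
      by_contra hc
      have := half_le_ridge hκ hκ2 hδ hδ2 (not_lt.1 hc) h2.le
      rw [hQq] at this
      nlinarith
    have hPq : P = κ ^ 2 * q := by
      have := ridge_of_le hκ hPlt.le (δ := δ)
      rw [hQq] at this
      field_simp at this
      nlinarith [this]
    refine ⟨by rw [hQq]; nlinarith, ?_⟩
    rw [hPq, pushP_base hκ q]

end Image

end PushModel

/-- **Registered helper `helper_pushModel` (brick (PUSH) of T3b (ii) — route A of the brief — sub-goal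
of NF6 `stub_steinRealisation`, wave 3, lead c5): there is an explicit push of the handle-chart image
`{x_λ ≠ 0}` of `X₁ ∖ γ`: a smooth torus-equivariant diffeomorphism `sh` of `{x_λ ≠ 0} ⊂ ℝ⁴` onto an
open set `V` with smooth inverse, the identity on `{‖x_λ‖² ≥ 3κ²/4}`, mapping the handle part
`{x_λ ≠ 0, ‖x‖ ≤ 1}` ONTO (handle ∖ the part `{H < 0}` of the cocore neighbourhood `N`) ∖ (the
circle `C = {x_μ = 0, ‖x_λ‖² = pFun κ 0}`), and the seam `{‖x‖ = 1, ‖x_λ‖² < 3κ²/4}` onto the new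
boundary `{H = 0}` (ridge `Q = ϱ(P)` / swap-slab boundary `P = pFun κ (Q/δ)`).**
(`sh = PushModel.modelPush κ δ`, `V = PushModel.pushInvDom κ δ`.) [folklore] -/
theorem helper_pushModel : ∀ {κ δ : ℝ}, 0 < κ → κ ≤ 1 / 2 → 0 < δ → δ ≤ 1 / 2 → ∃ (sh shInv : EuclideanSpace ℝ (Fin 4) → EuclideanSpace ℝ (Fin 4)) (V : Set (EuclideanSpace ℝ (Fin 4))), IsOpen V ∧ ContDiffOn ℝ ∞ sh {x : EuclideanSpace ℝ (Fin 4) | Literature.Topology.FourManifolds.lamPart x ≠ 0} ∧ ContDiffOn ℝ ∞ shInv V ∧ sh '' {x : EuclideanSpace ℝ (Fin 4) | Literature.Topology.FourManifolds.lamPart x ≠ 0} = V ∧ (∀ x : EuclideanSpace ℝ (Fin 4), Literature.Topology.FourManifolds.lamPart x ≠ 0 → shInv (sh x) = x) ∧ (∀ x ∈ V, sh (shInv x) = x) ∧ (∀ x : EuclideanSpace ℝ (Fin 4), 3 * κ ^ 2 / 4 ≤ ‖Literature.Topology.FourManifolds.lamPart x‖ ^ 2 → sh x = x) ∧ (∀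 x : EuclideanSpace ℝ (Fin 4), Literature.Topology.FourManifolds.lamPart x ≠ 0 → ∃ a b : ℝ, 0 < a ∧ 0 < b ∧ Literature.Topology.FourManifolds.lamPart (sh x) = a • Literature.Topology.FourManifolds.lamPart x ∧ Literature.Topology.FourManifolds.muPart (sh x) = b • Literature.Topology.FourManifolds.muPart x) ∧ sh '' {x : EuclideanSpace ℝ (Fin 4) | Literature.Topology.FourManifolds.lamPart x ≠ 0 ∧ ‖x‖ ≤ 1} = {x : EuclideanSpace ℝ (Fin 4) | ‖x‖ ≤ 1 ∧ ‖Literature.Topology.FourManifolds.muPart x‖ ^ 2 ≤ Summit.SmoothPoincare4.SmoothPoincare4.Theorems.AcyclicBisectionExists.ModpBraidOrbits.PushModel.ridge κ δ (‖Literature.Topology.FourManifolds.lamPart x‖ ^ 2) ∧ (δ / 4 ≤ ‖Literature.Topology.FourManifolds.muPart x‖ ^ 2 ∨ Summit.SmoothPoincare4.SmoothPoincare4.Theorems.AcyclicBisectionExists.ModpBraidOrbits.pFun κ (‖Literature.Topology.FourManifolds.muPart x‖ ^ 2 / δ) ≤ ‖Literature.Topology.FourManifolds.lamPart x‖ ^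 2) ∧ (Literature.Topology.FourManifolds.muPart x = 0 → Summit.SmoothPoincare4.SmoothPoincare4.Theorems.AcyclicBisectionExists.ModpBraidOrbits.pFun κ 0 < ‖Literature.Topology.FourManifolds.lamPart x‖ ^ 2)} ∧ (∀ x : EuclideanSpace ℝ (Fin 4), Literature.Topology.FourManifolds.lamPart x ≠ 0 → ‖x‖ = 1 → ‖Literature.Topology.FourManifolds.lamPart x‖ ^ 2 < 3 * κ ^ 2 / 4 → (δ / 4 ≤ ‖Literature.Topology.FourManifolds.muPart (sh x)‖ ^ 2 ∧ ‖Literature.Topology.FourManifolds.muPart (sh x)‖ ^ 2 = Summit.SmoothPoincare4.SmoothPoincare4.Theorems.AcyclicBisectionExists.ModpBraidOrbits.PushModel.ridge κ δ (‖Literature.Topology.FourManifolds.lamPart (sh x)‖ ^ 2)) ∨ (‖Literature.Topology.FourManifolds.muPart (sh x)‖ ^ 2 < δ / 4 ∧ ‖Literature.Topology.FourManifolds.lamPart (sh x)‖ ^ 2 = Summit.SmoothPoincare4.SmoothPoincare4.Theorems.AcyclicBisectionExists.ModpBraidOrbits.pFun κ (‖Literature.Topology.FourManifolds.muPart (sh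 x)‖ ^ 2 / δ))) := by
  intro κ δ hκ hκ2 hδ hδ2
  obtain ⟨hV, hsh, hinv, himg, hl, hr, hid, hdir⟩ := helper_modelPush_diffeo hκ hκ2 hδ
  exact ⟨PushModel.modelPush κ δ, PushModel.modelPushInv κ δ, PushModel.pushInvDom κ δ, hV, hsh, hinv, himg, hl,
    hr, hid, hdir, PushModel.image_modelPush_ball hκ hκ2 hδ hδ2,
    fun x hx h1 h2 => PushModel.modelPush_seam hκ hκ2 hδ hδ2 hx h1 h2⟩

end Summit.SmoothPoincare4.SmoothPoincare4.Theorems.AcyclicBisectionExists.ModpBraidOrbits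

end
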